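import Summits.BirchSwinnertonDyer.BirchSwinnertonDyer.Theorems.ErratumRoadFiveEulerHalfNotRamTransport
import HarnessLib

/-!
# Route `ErratumRoadFive`, crux `EulerHalfNotRamNoInertSetAtFive` (item stmt-BirchSwinnertonDyer-19715) — the
# receptacle-shaped Pasten package KEEPING THE WHOLE OF Lemma 6.18 (Papikian–Rabinoff: the cokernel at an odd prime
# `q` of the level divides `q − 1`, AND the cokernel at `q = 2` divides `2`), and (DEG) by a pairing whose half may
# contain the prime `2` when the BSD prime is odd

Cell `bsd-stepL` (run/shared/lean/pub/bsd-stepL/), seat `bsd-line-er5-p1-w2` (D-0154 width seat -w2 on crux 19715),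
`--supports stmt-BirchSwinnertonDyer-19715`.

`Theorems/ErratumRoadFiveShimuraSkolemPackageCoker.lean` (shim-p1 g3, `ribetTakahashiPackageCoker_of_componentOrders`)
exports, from the typer's `Literature.NumberTheory.Automorphic.PastenShimura2024_componentOrders`, the receptacle shapes
(P613), (Pij), (P68), (PEis) and the ninth conjunct (P618) `∀ D ⊆ Mult(E) even, ∀ q ∈ D, q ≠ 2 → κ D q ∣ q − 1` —
the ODD half of the typer's `ComponentOrders.CokernelDvd`, which renders Pasten's printed Lemma 6.18 IN FULL: «Let `p`
be a prime with `p ∣ D`. Then `j_p(D,M)` divides `p − 1` if `p` is odd, and it divides `2` if `p = 2`.» For the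
(DEG) telescoping at an ODD BSD prime `ℓ` (here `ℓ ≥ 5`) the `q = 2` clause is exactly as good as the odd one: a
cokernel dividing `2` is an `ℓ`-adic unit. So the Papikian–Rabinoff pairing of the inert line
(`padicValNat_delta_empty_eq_of_oddPairing`: a half-size subset `R ⊆ S` of ODD primes `q ≢ 1 mod ℓ`) extends to
half-size subsets `R` whose members are `2` or odd primes `q ≢ 1 mod ℓ` — for BOTH Shimura lines (`p ∈ S` inert,
`p ∉ S` split). On crux 19715's census this is what the five three-prime pairs `19170s1`, `167310f1`, `410130dv1`,
`410130en1`, `410130fc1` @5 (offending primes `2` and one `q ≡ 1 mod 5`) need: `R = {2}`; and the crux's own typed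
«no inert-set datum» clause `∀ q ∈ R, q ≠ 2 ∧ ¬ p ∣ q − 1` is STRICTER than what the printed lemma supports
(`q = 2 ∨ ¬ p ∣ q − 1` suffices at `p ≥ 3`) — recorded for the planner; no statement is edited here.

* `ribetTakahashiPackageCokerTwo_of_componentOrders` — g3's theorem VERBATIM (same construction of `δ, cA, ι, κ` from
  the chosen class-minimal data) with the ninth conjunct replaced by the FULL Lemma-6.18 clause
  `∀ D ⊆ Mult(E) even, ∀ q ∈ D, (q ≠ 2 → κ D q ∣ q − 1) ∧ (q = 2 → κ D q ∣ 2)`, proved from `CokernelDvd` (both halves).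
  -- adapted from Summits/BirchSwinnertonDyer/BirchSwinnertonDyer/Theorems/ErratumRoadFiveShimuraSkolemPackageCoker.lean
* `padicValNat_delta_empty_eq_of_pairingTwo` — (DEG) `ord_ℓ δ(∅) = ord_ℓ δ(S) + Σ_{q∈S} ord_ℓ c_q(E)` at an odd prime
  `ℓ` from (P613) + (Pij) + (P68) + (PEis) + the full (P618), for an even `S ⊆ Mult` with a half-size subset `R` of
  primes each of which is `2` or satisfies `ℓ ∤ q − 1` — the induction of `padicValNat_delta_empty_eq_of_oddPairing`
  verbatim up to the cokernel step at `q = 2`.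
  -- adapted from Summits/BirchSwinnertonDyer/BirchSwinnertonDyer/Theorems/ErratumRoadFiveEulerHalfNotRamTransport.lean

HONEST FRAMING: CONDITIONAL on the named facts taken as hypotheses (all PUBLISHED: Pasten 2024 §6, Ribet–Takahashi 1997,
Papikian–Rabinoff 2016, Jacquet–Langlands); THEOREMS ONLY, no definition, no named fact, no `sorry`; nothing booked; BSD
is not proved by any of this.
-/

noncomputable section

open scoped Classical

open WeierstrassCurve NumberField Literature.NumberTheory.EllipticCurves
  Literature.NumberTheory.EllipticCurves.ModularForms Literature.NumberTheory.Automorphic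
  Literature.NumberTheory.EllipticCurves.Rank1Residual
  Summit.BirchSwinnertonDyer.Rank1Residual Summit.BirchSwinnertonDyer.Rank1Residual.X11b

-- the cell's Theorems namespace repeats the summit name (Summit.<Summit>.<Problem>), as in every sibling file
set_option linter.dupNamespace false

namespace Summit.BirchSwinnertonDyer.BirchSwinnertonDyer.Theorems

/-! ### The package with the FULL Lemma 6.18 -/

/-- **The receptacle-shaped Pasten package WITH THE FULL (P618)** (shape of
`Literature.NumberTheory.Automorphic.PastenShimura2024_ribetTakahashiPackage`, existential anchor, plus Lemma 6.18 at
every prime of the level: `κ D q ∣ q − 1` for odd `q ∈ D` and `κ D 2 ∣ 2` for `2 ∈ D`, `D ⊆ Mult(E)` even) from the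
typer's Skolem-function facts (`CokernelDvd` at the chosen class-minimal datum of level `(∏D, N/∏D)`). g3's
`ribetTakahashiPackageCoker_of_componentOrders` verbatim but for the last conjunct.
[cite: PastenShimura2024, Prop. 6.13 and §6.6 (p. 23), Lemma 6.8 (p. 22), Lemma 6.14 (p. 23), Lemma 6.18 (p. 24), §2 (p. 12)]
[cite: PapikianRabinoff2016, Cor. 3.5 (through Pasten Lemma 6.18)] -/
theorem ribetTakahashiPackageCokerTwo_of_componentOrders
    (hCO : PastenShimura2024_componentOrders) (h68 : PastenShimura2024_lemma_6_8_isogeny)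
    (hJL : nonempty_shimuraParametrizationData)
    (W : WeierstrassCurve ℚ) [W.IsElliptic] [W.IsGloballyMinimal] (p : ℕ) [Fact p.Prime]
    (hirr : W.HasIrreducibleModPGaloisRep p)
    (N : ℕ) [NeZero N] (W₀ : WeierstrassCurve ℚ) [W₀.IsElliptic] [W₀.IsGloballyMinimal]
    (D₀ : ModularParametrizationData W₀ N)
    (hN : W.conductorNorm ℤ = N) (hfW : IsNewformOf W D₀.f)
    (hmin : ∀ (W₂ : WeierstrassCurve ℚ) [W₂.IsElliptic] (D₂ : ModularParametrizationData W₂ N),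
      D₂.f = D₀.f → D₀.modularDegree ≤ D₂.modularDegree) :
    ∃ (δ : Finset ℕ → ℕ) (cA ι κ : Finset ℕ → ℕ → ℕ),
      δ ∅ = D₀.modularDegree ∧
      (∀ D, 0 < δ D) ∧ (∀ D q, 0 < cA D q) ∧
      -- existential anchor: one class-minimal Shimura datum per admissible level realises `δ D`
      (∀ ⦃D : Finset ℕ⦄, D ⊆ (W.conductorNorm ℤ).primeFactors.filter
            (fun q ↦ ∃ h : q.Prime, @WeierstrassCurve.HasMultiplicativeReductionAtPrime W q ⟨h⟩) →
          Even D.card →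
        ∃ (X : ShimuraCurveData (∏ q ∈ D, q) (N / ∏ q ∈ D, q)) (W' : WeierstrassCurve ℚ)
          (_ : W'.IsElliptic) (P : ShimuraParametrizationData X W'), P.IsMinimalFor W ∧ P.deg = δ D) ∧
      -- (P613)
      (∀ ⦃d : Finset ℕ⦄, d ⊆ (W.conductorNorm ℤ).primeFactors.filter
            (fun q ↦ ∃ h : q.Prime, @WeierstrassCurve.HasMultiplicativeReductionAtPrime W q ⟨h⟩) →
          Even d.card →
        ∀ ⦃q r : ℕ⦄,
          q ∈ (W.conductorNorm ℤ).primeFactors.filter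
            (fun q ↦ ∃ h : q.Prime, @WeierstrassCurve.HasMultiplicativeReductionAtPrime W q ⟨h⟩) →
          r ∈ (W.conductorNorm ℤ).primeFactors.filter
            (fun q ↦ ∃ h : q.Prime, @WeierstrassCurve.HasMultiplicativeReductionAtPrime W q ⟨h⟩) →
          q ∉ d → r ∉ d → q ≠ r →
          δ d * ι d q ^ 2 * κ (insert q (insert r d)) r ^ 2 =
            δ (insert q (insert r d)) * cA d q * cA (insert q (insert r d)) r) ∧
      -- (Pij)
      (∀ ⦃D : Finset ℕ⦄, D ⊆ (W.conductorNorm ℤ).primeFactors.filter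
            (fun q ↦ ∃ h : q.Prime, @WeierstrassCurve.HasMultiplicativeReductionAtPrime W q ⟨h⟩) →
        ∀ ⦃q : ℕ⦄, q ∈ (W.conductorNorm ℤ).primeFactors.filter
            (fun q ↦ ∃ h : q.Prime, @WeierstrassCurve.HasMultiplicativeReductionAtPrime W q ⟨h⟩) →
          ι D q * κ D q = cA D q) ∧
      -- (P68)
      (∀ ⦃D : Finset ℕ⦄, D ⊆ (W.conductorNorm ℤ).primeFactors.filter
            (fun q ↦ ∃ h : q.Prime, @WeierstrassCurve.HasMultiplicativeReductionAtPrime W q ⟨h⟩) →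
        ∃ n : ℕ, 0 < n ∧ ¬ p ∣ n ∧
          ∀ q ∈ (W.conductorNorm ℤ).primeFactors.filter
              (fun q ↦ ∃ h : q.Prime, @WeierstrassCurve.HasMultiplicativeReductionAtPrime W q ⟨h⟩),
            cA D q ∣ n * padicValInt q W.minimalDiscriminantInt ∧
              padicValInt q W.minimalDiscriminantInt ∣ n * cA D q) ∧
      -- (PEis)
      (∀ ⦃d : Finset ℕ⦄, d ⊆ (W.conductorNorm ℤ).primeFactors.filter
            (fun q ↦ ∃ h : q.Prime, @WeierstrassCurve.HasMultiplicativeReductionAtPrime W q ⟨h⟩) →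
        ∀ ⦃q : ℕ⦄, q ∈ (W.conductorNorm ℤ).primeFactors.filter
            (fun q ↦ ∃ h : q.Prime, @WeierstrassCurve.HasMultiplicativeReductionAtPrime W q ⟨h⟩) →
          q ∉ d → ∀ r : ℕ, r.Prime → ¬ r ∣ W.conductorNorm ℤ →
            (ι d q : ℤ) ∣ (r : ℤ) + 1 - W.LFunction r) ∧
      -- (P618) Pasten Lemma 6.18 (Papikian–Rabinoff), FULL: the cokernel at a prime `q` OF THE LEVEL divides
      -- `q − 1` if `q` is odd, and divides `2` if `q = 2`
      (∀ ⦃D : Finset ℕ⦄, D ⊆ (W.conductorNorm ℤ).primeFactors.filter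
            (fun q ↦ ∃ h : q.Prime, @WeierstrassCurve.HasMultiplicativeReductionAtPrime W q ⟨h⟩) →
          Even D.card → ∀ ⦃q : ℕ⦄, q ∈ D → (q ≠ 2 → κ D q ∣ q - 1) ∧ (q = 2 → κ D q ∣ 2)) := by
  have hp : p.Prime := Fact.out
  obtain ⟨cI, cJ, hpos, hProd, h613, hEis, hCok⟩ := hCO
  -- the multiplicative primes: `q ∥ N`
  set Mlt : Finset ℕ := (W.conductorNorm ℤ).primeFactors.filter
    (fun q ↦ ∃ h : q.Prime, @WeierstrassCurve.HasMultiplicativeReductionAtPrime W q ⟨h⟩) with hMlt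
  have hMlt_exact : ∀ q ∈ Mlt, q.Prime ∧ q ∣ N ∧ ¬ q ^ 2 ∣ N := by
    intro q hq
    obtain ⟨hqN, hqp, hm⟩ := Finset.mem_filter.mp hq
    haveI : Fact q.Prime := ⟨hqp⟩
    refine ⟨hqp, hN ▸ (Nat.mem_primeFactors.mp hqN).2.1, hN ▸ not_sq_dvd_conductorNorm_of_mult W q hm⟩
  have hMlt_cpos : ∀ q ∈ Mlt, 0 < padicValInt q W.minimalDiscriminantInt := by
    intro q hq
    obtain ⟨-, hqp, hm⟩ := Finset.mem_filter.mp hq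
    haveI : Fact q.Prime := ⟨hqp⟩
    exact padicValInt_minimalDiscriminantInt_pos_of_mult W q hm
  -- admissible levels and the chosen class-minimal data (Jacquet–Langlands)
  have hNpos : 0 < N := Nat.pos_of_ne_zero (NeZero.ne N)
  have hadm : ∀ D : Finset ℕ, D ⊆ Mlt ∧ Even D.card →
      IsAdmissibleFactorization N (∏ q ∈ D, q) (N / ∏ q ∈ D, q) :=
    fun D h ↦ isAdmissibleFactorization_prod_of_even hNpos (fun ℓ hℓ ↦ hMlt_exact ℓ (h.1 hℓ)) h.2
  have hex : ∀ D : Finset ℕ, D ⊆ Mlt ∧ Even D.card →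
      ∃ (X : ShimuraCurveData (∏ q ∈ D, q) (N / ∏ q ∈ D, q)) (W' : WeierstrassCurve ℚ)
        (_ : W'.IsElliptic) (P : ShimuraParametrizationData X W'), P.IsMinimalFor W := by
    intro D h
    obtain ⟨X⟩ := nonempty_shimuraCurveData_holds (hadm D h)
    obtain ⟨W', hW', P, hP⟩ :=
      ShimuraParametrizationData.exists_isMinimalFor_of_nonempty (hJL (hadm D h) X W hN)
    exact ⟨X, W', hW', P, hP⟩
  choose X W' hW'e P hPmin using hex
  -- the `D = 1` bridge at the empty level: `δ^{Sh}_{1,N} = δ_{1,N}`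
  have hbridge : ∀ {Dn Mn : ℕ} (_ : Dn = 1) (_ : Mn = N) {Xe : ShimuraCurveData Dn Mn}
      {We : WeierstrassCurve ℚ} [We.IsElliptic] {Pe : ShimuraParametrizationData Xe We},
      Pe.IsMinimalFor W → Pe.deg = D₀.modularDegree := by
    intro Dn Mn hD hM Xe We _ Pe hPe
    subst hD; subst hM
    exact hPe.deg_eq_modularDegree D₀ hfW hmin
  -- the four functions
  refine ⟨fun D ↦ if h : D ⊆ Mlt ∧ Even D.card then (P D h).deg else D₀.modularDegree,
    fun D q ↦ if h : D ⊆ Mlt ∧ Even D.card then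
        (if q ∈ Mlt then ((W' D h).minimalDiscriminantNorm ℤ).factorization q else 1)
      else (if q ∈ Mlt then padicValInt q W.minimalDiscriminantInt else 1),
    fun D q ↦ if h : D ⊆ Mlt ∧ Even D.card then cI (P D h) q else 1,
    fun D q ↦ if h : D ⊆ Mlt ∧ Even D.card then cJ (P D h) q
      else (if q ∈ Mlt then padicValInt q W.minimalDiscriminantInt else 1),
    ?_, ?_, ?_, ?_, ?_, ?_, ?_, ?_, ?_⟩
  ---------------------------------------------------------------- pin
  · have h0 : (∅ : Finset ℕ) ⊆ Mlt ∧ Even (∅ : Finset ℕ).card := ⟨Finset.empty_subset _, by simp⟩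
    simp only [dif_pos h0]
    haveI := hW'e ∅ h0
    exact hbridge Finset.prod_empty (by rw [Finset.prod_empty, Nat.div_one]) (hPmin ∅ h0)
  ---------------------------------------------------------------- positivity of `δ`
  · intro D
    by_cases h : D ⊆ Mlt ∧ Even D.card
    · simp only [dif_pos h]; exact (P D h).deg_pos
    · simp only [dif_neg h]; exact D₀.deg_pos
  ---------------------------------------------------------------- positivity of `cA`
  · intro D q
    by_cases h : D ⊆ Mlt ∧ Even D.card
    · by_cases hq : q ∈ Mlt
      · simp only [dif_pos h, if_pos hq]
        haveI := hW'e D h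
        obtain ⟨hqp, hqN, hq2⟩ := hMlt_exact q hq
        have := hProd (hadm D h) (X D h) W hN (W' D h) (P D h) (hPmin D h) q hqp hqN hq2
        rw [← this]
        exact Nat.mul_pos (hpos (P D h) q).1 (hpos (P D h) q).2
      · simp only [dif_pos h, if_neg hq]; exact one_pos
    · by_cases hq : q ∈ Mlt
      · simp only [dif_neg h, if_pos hq]; exact hMlt_cpos q hq
      · simp only [dif_neg h, if_neg hq]; exact one_pos
  ---------------------------------------------------------------- existential anchor
  · intro D hD hDe
    have h : D ⊆ Mlt ∧ Even D.card := ⟨hD, hDe⟩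
    refine ⟨X D h, W' D h, hW'e D h, P D h, hPmin D h, ?_⟩
    simp only [dif_pos h]
  ---------------------------------------------------------------- (P613)
  · intro d hd hde q r hq hr hqd hrd hqr
    have hq' : q ∉ insert r d := by simp [hqr, hqd]
    set D' : Finset ℕ := insert q (insert r d) with hD'
    have hdA : d ⊆ Mlt ∧ Even d.card := ⟨hd, hde⟩
    have hD'A : D' ⊆ Mlt ∧ Even D'.card := by
      refine ⟨?_, ?_⟩
      · intro x hx
        rcases Finset.mem_insert.mp hx with rfl | hx
        · exact hq
        rcases Finset.mem_insert.mp hx with rfl | hx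
        · exact hr
        · exact hd hx
      · rw [hD', Finset.card_insert_of_notMem hq', Finset.card_insert_of_notMem hrd]
        obtain ⟨k, hk⟩ := hde
        exact ⟨k + 1, by omega⟩
    obtain ⟨hqp, -, -⟩ := hMlt_exact q hq
    obtain ⟨hrp, -, -⟩ := hMlt_exact r hr
    haveI := hW'e d hdA
    haveI := hW'e D' hD'A
    -- the level arithmetic: `∏D' = (∏d)·(q·r)` and `N/∏d = q·r·(N/∏D')`
    have hprod : ∏ x ∈ D', x = (∏ x ∈ d, x) * (q * r) := by
      rw [hD', Finset.prod_insert hq', Finset.prod_insert hrd]; ring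
    have hadmD' := hadm D' hD'A
    have hdivD' : (∏ x ∈ D', x) * (N / ∏ x ∈ D', x) = N := hadmD'.mul_eq
    have hdpos : 0 < ∏ x ∈ d, x := Finset.prod_pos fun x hx ↦ (hMlt_exact x (hd hx)).1.pos
    have hlevel : N / ∏ x ∈ d, x = q * r * (N / ∏ x ∈ D', x) := by
      have : N = (∏ x ∈ d, x) * (q * r * (N / ∏ x ∈ D', x)) := by
        rw [← mul_assoc, ← hprod]; exact hdivD'.symm
      conv_lhs => rw [this]
      rw [Nat.mul_div_cancel_left _ hdpos]
    have key := h613 hqp hrp hqr hprod hlevel hadmD' (X d hdA) (X D' hD'A) W hN (W' d hdA) (P d hdA)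
      (hPmin d hdA) (W' D' hD'A) (P D' hD'A) (hPmin D' hD'A)
    -- unfold the four functions at the admissible levels `d`, `D'`
    simp only [dif_pos hdA, dif_pos hD'A, if_pos hq, if_pos hr]
    calc (P d hdA).deg * cI (P d hdA) q ^ 2 * cJ (P D' hD'A) r ^ 2
        = (P d hdA).deg * (cI (P d hdA) q ^ 2 * cJ (P D' hD'A) r ^ 2) := by ring
      _ = (P D' hD'A).deg * (((W' d hdA).minimalDiscriminantNorm ℤ).factorization q *
            ((W' D' hD'A).minimalDiscriminantNorm ℤ).factorization r) := key
      _ = _ := by ring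
  ---------------------------------------------------------------- (Pij)
  · intro D hD q hq
    by_cases h : D ⊆ Mlt ∧ Even D.card
    · haveI := hW'e D h
      obtain ⟨hqp, hqN, hq2⟩ := hMlt_exact q hq
      simp only [dif_pos h, if_pos hq]
      exact hProd (hadm D h) (X D h) W hN (W' D h) (P D h) (hPmin D h) q hqp hqN hq2
    · simp only [dif_neg h, if_pos hq, one_mul]
  ---------------------------------------------------------------- (P68)
  · intro D hD
    by_cases h : D ⊆ Mlt ∧ Even D.card
    · haveI := hW'e D h
      -- an isogeny `W → A_D` of degree prime to `p` (`E[p]` irreducible)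
      have hp0 : (p : ℚ) ≠ 0 := by exact_mod_cast hp.ne_zero
      obtain ⟨lam, hlam⟩ :=
        Literature.NumberTheory.EllipticCurves.SkinnerUrban2014.exists_isogeny_not_dvd_degree_of_irreducible
          hp0 hirr (hPmin D h).1
      refine ⟨lam.degree, lam.degree_pos, hlam, fun q hq ↦ ?_⟩
      obtain ⟨hqp, hqN, hq2⟩ := hMlt_exact q hq
      obtain ⟨a, b, ha, hb, haD, hbD, hEq⟩ := h68 W (W' D h) lam q hqp (hN ▸ hqN) (hN ▸ hq2)
      simp only [dif_pos h, if_pos hq]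
      rw [padicValInt_minimalDiscriminantInt_eq_factorization W hqp]
      set cW := (W.minimalDiscriminantNorm ℤ).factorization q
      set cW' := ((W' D h).minimalDiscriminantNorm ℤ).factorization q
      -- `cW · b = a · cW'` with `a, b ∣ deg λ`
      refine ⟨?_, ?_⟩
      · -- `cW' ∣ deg λ · cW`
        have h1 : cW' ∣ cW * b := ⟨a, by rw [hEq]; ring⟩
        exact h1.trans (by rw [mul_comm]; exact Nat.mul_dvd_mul_right hbD cW)
      · -- `cW ∣ deg λ · cW'`
        have h1 : cW ∣ a * cW' := ⟨b, by rw [← hEq]⟩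
        exact h1.trans (Nat.mul_dvd_mul_right haD cW')
    · refine ⟨1, one_pos, hp.one_lt.ne' ∘ (Nat.dvd_one.mp ·), fun q hq ↦ ?_⟩
      simp only [dif_neg h, if_pos hq, one_mul, dvd_refl, and_self]
  ---------------------------------------------------------------- (PEis)
  · intro d hd q hq hqd r' hr' hr'N
    by_cases h : d ⊆ Mlt ∧ Even d.card
    · haveI := hW'e d h
      obtain ⟨hqp, hqN, hq2⟩ := hMlt_exact q hq
      have hadmd := hadm d h
      -- `q ∥ N/∏d`: `q` is a multiplicative prime outside `d`
      have hqprod : ¬ q ∣ ∏ x ∈ d, x := by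
        intro hdiv
        obtain ⟨x, hx, hqx⟩ := (Prime.dvd_finsetProd_iff hqp.prime _).mp hdiv
        have : q = x := (Nat.prime_dvd_prime_iff_eq hqp (hMlt_exact x (hd hx)).1).mp hqx
        exact hqd (this ▸ hx)
      have hqM : q ∣ N / ∏ x ∈ d, x := by
        have : q ∣ (∏ x ∈ d, x) * (N / ∏ x ∈ d, x) := by rw [hadmd.mul_eq]; exact hqN
        exact ((Nat.Prime.dvd_mul hqp).mp this).resolve_left hqprod
      have hq2M : ¬ q ^ 2 ∣ N / ∏ x ∈ d, x := fun h2 ↦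
        hq2 (h2.trans (Nat.div_dvd_of_dvd (Dvd.intro _ hadmd.mul_eq)))
      have key := hEis hadmd (X d h) W hN (W' d h) (P d h) (hPmin d h) q hqp hqM hq2M r' hr'
        (hN ▸ hr'N)
      simp only [dif_pos h]
      rw [LFunction_eq_of_isIsogenous_holds W (W' d h) (hPmin d h).1]
      exact_mod_cast key
    · simp only [dif_neg h, Nat.cast_one, one_dvd]

  ---------------------------------------------------------------- (P618)
  · intro D hD hDe q hqD
    have h : D ⊆ Mlt ∧ Even D.card := ⟨hD, hDe⟩
    haveI := hW'e D h
    obtain ⟨hqp, -, -⟩ := hMlt_exact q (hD hqD)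
    have hqdvd : q ∣ ∏ x ∈ D, x := Finset.dvd_prod_of_mem _ hqD
    simp only [dif_pos h]
    exact hCok (hadm D h) (X D h) W hN (W' D h) (P D h) (hPmin D h) q hqp hqdvd


/-! ### (DEG) by the Papikian–Rabinoff pairing with `2` allowed in the half, at an odd BSD prime -/

section PairingTwo

variable {ℓ : ℕ} [Fact ℓ.Prime]
  {Mult : Finset ℕ} {δ : Finset ℕ → ℕ} {cA ι κ : Finset ℕ → ℕ → ℕ} {c : ℕ → ℕ}
  -- (P613) Pasten Prop. 6.13 (both expressions, by symmetry in `q`, `r`)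
  (h613 : ∀ ⦃d : Finset ℕ⦄, d ⊆ Mult → Even d.card → ∀ ⦃q r : ℕ⦄, q ∈ Mult → r ∈ Mult →
    q ∉ d → r ∉ d → q ≠ r →
    δ d * ι d q ^ 2 * κ (insert q (insert r d)) r ^ 2 =
      δ (insert q (insert r d)) * cA d q * cA (insert q (insert r d)) r)
  (hδ : ∀ D, 0 < δ D) (hcA : ∀ D q, 0 < cA D q)
  (hij : ∀ ⦃D : Finset ℕ⦄, D ⊆ Mult → ∀ ⦃q : ℕ⦄, q ∈ Mult → ι D q * κ D q = cA D q)
  (hvA : ∀ ⦃D : Finset ℕ⦄, D ⊆ Mult → ∀ ⦃q : ℕ⦄, q ∈ Mult →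
    padicValNat ℓ (cA D q) = padicValNat ℓ (c q))
  (hι : ∀ ⦃d : Finset ℕ⦄, d ⊆ Mult → ∀ ⦃q : ℕ⦄, q ∈ Mult → q ∉ d → padicValNat ℓ (ι d q) = 0)
  -- (P618) FULL, in the shape of `ribetTakahashiPackageCokerTwo_of_componentOrders`
  (h618 : ∀ ⦃D : Finset ℕ⦄, D ⊆ Mult → Even D.card → ∀ ⦃q : ℕ⦄, q ∈ D →
    (q ≠ 2 → κ D q ∣ q - 1) ∧ (q = 2 → κ D q ∣ 2))
  -- the BSD prime is odd
  (hℓ2 : ℓ ≠ 2)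

include h613 hδ hcA hij hvA hι h618 hℓ2

/-- **(DEG) from the FULL Papikian–Rabinoff cokernel bound at an odd prime `ℓ`.** If (P618) holds at every prime of
every even level `D ⊆ Mult` (`j_q ∣ q − 1` for odd `q`, `j_2 ∣ 2`), and the even set `S ⊆ Mult` has a subset `R` of half
its size each of whose members is `2` or a prime `q` with `ℓ ∤ q − 1`, then pairing each prime of `S ∖ R` with one of
`R` (cokernel taken on the `R`-side: an `ℓ`-adic unit, since `ℓ` is odd) gives
`ord_ℓ δ(∅) = ord_ℓ δ(S) + Σ_{q∈S} ord_ℓ c_q(E)`. The induction of `padicValNat_delta_empty_eq_of_oddPairing` with the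
cokernel step at `q = 2` added. [cite: PastenShimura2024, Lemma 6.18 and §6.9 (arXiv v4 pp. 32–33)]
[cite: PapikianRabinoff2016, Cor. 3.5] -/
theorem padicValNat_delta_empty_eq_of_pairingTwo :
    ∀ (n : ℕ) (S R : Finset ℕ), S ⊆ Mult → R ⊆ S → S.card = 2 * n → R.card = n →
      (∀ q ∈ R, q = 2 ∨ ¬ ℓ ∣ q - 1) →
      padicValNat ℓ (δ ∅) = padicValNat ℓ (δ S) + ∑ x ∈ S, padicValNat ℓ (c x) := by
  intro n
  induction n with
  | zero =>
    intro S R _ _ hS _ _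
    rw [Finset.card_eq_zero.mp (by omega : S.card = 0)]
    simp
  | succ n IH =>
    intro S R hS hRS hScard hRcard hR
    have hSe : Even S.card := ⟨n + 1, by omega⟩
    -- `r ∈ R`, `q ∈ S ∖ R`
    obtain ⟨r, hrR⟩ : R.Nonempty := Finset.card_pos.mp (by omega)
    have hrS : r ∈ S := hRS hrR
    have hne : (S \ R).Nonempty := by
      apply Finset.card_pos.mp
      rw [Finset.card_sdiff_of_subset hRS]; omega
    obtain ⟨q, hq⟩ := hne
    obtain ⟨hqS, hqR⟩ := Finset.mem_sdiff.mp hq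
    have hqr : q ≠ r := fun h ↦ hqR (h ▸ hrR)
    set d := (S.erase q).erase r with hd_def
    have hrq' : r ∈ S.erase q := Finset.mem_erase.mpr ⟨hqr.symm, hrS⟩
    have hSeq : insert q (insert r d) = S := by
      rw [hd_def, Finset.insert_erase hrq', Finset.insert_erase hqS]
    have hdS : d ⊆ S := (Finset.erase_subset _ _).trans (Finset.erase_subset _ _)
    have hd : d ⊆ Mult := hdS.trans hS
    have hqd : q ∉ d := fun h ↦ (Finset.notMem_erase q S) ((Finset.erase_subset r _) h)
    have hrd : r ∉ d := Finset.notMem_erase r _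
    have hdcard : d.card = 2 * n := by
      have h1 := Finset.card_erase_of_mem hqS
      have h2' := Finset.card_erase_of_mem hrq'
      rw [hd_def]; omega
    have hde : Even d.card := ⟨n, by omega⟩
    -- the new `R`
    have hR'd : R.erase r ⊆ d := by
      intro x hx
      obtain ⟨hxr, hxR⟩ := Finset.mem_erase.mp hx
      have hxq : x ≠ q := fun h ↦ hqR (h ▸ hxR)
      exact Finset.mem_erase.mpr ⟨hxr, Finset.mem_erase.mpr ⟨hxq, hRS hxR⟩⟩
    have hR'card : (R.erase r).card = n := by rw [Finset.card_erase_of_mem hrR]; omega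
    have IH' := IH d (R.erase r) hd hR'd hdcard hR'card
      (fun x hx ↦ hR x (Finset.mem_of_mem_erase hx))
    -- the cokernel at `r` of level `S` divides `r - 1` (odd `r`) or `2` (`r = 2`): an `ℓ`-unit either way
    have hℓ : ℓ.Prime := Fact.out
    have hκ : padicValNat ℓ (κ (insert q (insert r d)) r) = 0 := by
      rw [hSeq]
      apply padicValNat.eq_zero_of_not_dvd
      intro hdvd
      by_cases hr2 : r = 2
      · have h2 : ℓ ∣ 2 := dvd_trans hdvd ((h618 hS hSe hrS).2 hr2)
        exact hℓ2 ((Nat.prime_dvd_prime_iff_eq hℓ Nat.prime_two).mp h2)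
      · exact ((hR r hrR).resolve_left hr2) (dvd_trans hdvd ((h618 hS hSe hrS).1 hr2))
    have := RTDegree.padicValNat_delta_empty_step h613 hδ hcA hij hvA hι hd hde (hS hqS) (hS hrS) hqd
      hrd hqr hκ IH'
    rwa [hSeq] at this

end PairingTwo

end Summit.BirchSwinnertonDyer.BirchSwinnertonDyer.Theorems

end
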